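import Mathlib
import Literature.NumberTheory.LFunctions.Zhang2022.TypedSection12CExact
import HarnessLib

/-!
# Zhang (2022) §12c, exact-window reading: bookkeeping identities for the nodes of `TypedSection12CExact`

Topic `Literature/NumberTheory/LFunctions/Zhang2022` (Landau–Siegel audit tree; verdict-neutral).
Y. Zhang, *Discrete mean estimates and the Landau–Siegel zero*, arXiv:2211.02515v1 (2022)
[Zhang2022LandauSiegel] — **an unrefereed manuscript under adjudication**; ZHANG-L lane, WP12 (typer seat).
THEOREMS ONLY (no new definition, no new fact), companion of the statement file `TypedSection12CExact`
(R-18 = RT-02 nodes `Top1225Ex`, `Top1522Ex`, `Win1217Ex`): the exact algebra the assembler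
`DedEval1217Ex` uses to pass from the per-`j` exact main terms to the weighted window values —
`main1213intEx = 𝔞/(0.504 log P)·Z1214Ex`, `main12u049intEx = 𝔞/(0.504 log P)·Z1216Ex`, and, with the weights
`(1/2α, 2/α, 3/2α)` of Proposition 7.1 and `α log P = π` ((2.10)), `Σ_j (w_j/α)·main1213intEx_j = 𝔞·e2starEx`,
`Σ_j (w_j/α)·main12u049intEx_j = 𝔞·e2starBarEx` (the exact twins of `Sec12D.weighted_main1214_eq` /
`Section12Eq1216Edge`'s `weighted_main_eq`). Nothing here bears on Theorems 1–2 of the manuscript or on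
Landau–Siegel zeros.

## References

* Y. Zhang, arXiv:2211.02515v1 (2022), §12 (12.13)–(12.17) pp. 71–73; (2.10) p. 6.
  [cite: Zhang2022LandauSiegel, §12 (12.15)–(12.16)]
-/

noncomputable section

open Complex Real ComplexConjugate

namespace Literature.NumberTheory.LFunctions.Zhang2022.Typed.Sec12C

open Literature.NumberTheory.LFunctions.Zhang2022.Skeleton

section Bookkeeping

variable (c' : ℝ) {D : ℕ} [NeZero D] (χ : DirichletCharacter ℂ D)

/-- `main1213intEx = 𝔞/(0.504 log P)·Z1214Ex` (regrouping of the prefactors). [cite: Zhang2022LandauSiegel, §12 (12.13)–(12.14) p.72] -/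
theorem main1213intEx_eq (j : ℕ) :
    main1213intEx c' χ j = frakA χ / (0.504 * Real.log (bigP D)) * Z1214Ex c' D j := by
  unfold main1213intEx Z1214Ex
  by_cases h : (Real.log (bigP D) : ℂ) = 0
  · simp [h]
  · have h498 : (0.498 : ℂ) ≠ 0 := by norm_num
    have h5 : (0.5 : ℂ) ≠ 0 := by norm_num
    have h504 : (0.504 : ℂ) ≠ 0 := by norm_num
    field_simp

/-- `main12u049intEx = 𝔞/(0.504 log P)·Z1216Ex`. [cite: Zhang2022LandauSiegel, §12 (12.16) p.73] -/
theorem main12u049intEx_eq (j : ℕ) :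
    main12u049intEx c' χ j = frakA χ / (0.504 * Real.log (bigP D)) * Z1216Ex c' D j := by
  unfold main12u049intEx Z1216Ex
  by_cases h : (Real.log (bigP D) : ℂ) = 0
  · simp [h]
  · have h498 : (0.498 : ℂ) ≠ 0 := by norm_num
    have h5 : (0.5 : ℂ) ≠ 0 := by norm_num
    have h504 : (0.504 : ℂ) ≠ 0 := by norm_num
    field_simp

omit [NeZero D] in
/-- `log P = 𝓛⁹ > 0` once `log D ≥ 1` ((2.6): `P = e^{𝓛⁹}`). [cite: Zhang2022LandauSiegel, §2 (2.6) p.6] -/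
theorem log_bigP_pos_of_one_le (hD : 1 ≤ Real.log D) : 0 < Real.log (bigP D) := by
  rw [bigP, Real.log_exp]
  exact pow_pos (by rw [ell]; linarith) 9

/-- **The weighted sum of the exact (12.13)-main terms is `𝔞·e₂*(D)`**: `Σ_j (w_j/α)·main1213intEx_j = 𝔞·e2starEx`
(`w = (1/2, 2, 3/2)`, `α log P = π`; for `log D ≥ 1`). [cite: Zhang2022LandauSiegel, §12 (12.15) p.72] -/
theorem weighted_main1213intEx_eq (hD : 1 ≤ Real.log D) :
    (1 / (2 * alpha D) * main1213intEx c' χ 1 + 2 / alpha D * main1213intEx c' χ 2 +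
        3 / (2 * alpha D) * main1213intEx c' χ 3 : ℂ) = frakA χ * e2starEx c' D := by
  have hlog : (Real.log (bigP D) : ℂ) ≠ 0 := by exact_mod_cast (log_bigP_pos_of_one_le hD).ne'
  have hπ : (π : ℂ) ≠ 0 := by exact_mod_cast Real.pi_ne_zero
  have h504 : (0.504 : ℂ) ≠ 0 := by norm_num
  simp only [main1213intEx_eq, e2starEx, alpha]
  push_cast
  field_simp

/-- **The weighted sum of the exact u049-main terms is `𝔞·ē₂*(D)`**: `Σ_j (w_j/α)·main12u049intEx_j = 𝔞·e2starBarEx`.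
[cite: Zhang2022LandauSiegel, §12 (12.16) p.73] -/
theorem weighted_main12u049intEx_eq (hD : 1 ≤ Real.log D) :
    (1 / (2 * alpha D) * main12u049intEx c' χ 1 + 2 / alpha D * main12u049intEx c' χ 2 +
        3 / (2 * alpha D) * main12u049intEx c' χ 3 : ℂ) = frakA χ * e2starBarEx c' D := by
  have hlog : (Real.log (bigP D) : ℂ) ≠ 0 := by exact_mod_cast (log_bigP_pos_of_one_le hD).ne'
  have hπ : (π : ℂ) ≠ 0 := by exact_mod_cast Real.pi_ne_zero
  have h504 : (0.504 : ℂ) ≠ 0 := by norm_num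
  simp only [main12u049intEx_eq, e2starBarEx, alpha]
  push_cast
  field_simp

end Bookkeeping

end Literature.NumberTheory.LFunctions.Zhang2022.Typed.Sec12C
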